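import Summits.Ventures.PercRepro.RankLevelSetRuleQSliceMapsAll
import Summits.Ventures.PercRepro.RankLevelSetRuleQModelRecv

/-!
# PercRepro — THE SLICE MAP OF RULE Q AT THE MATROID LEVEL: EXACT ON THE FAMILIES `5 ≤ k ≤ 7`
(night-1, gen 19; dossier §30)

The arithmetic map `rhat_slice_iff_all` becomes a statement about finite matroids once the model matroid
`T_{q+k}(U_{q,F} ⊕ free)` of RankLevelSetRuleQModelMatroid is read with its flat part: for a `q`-subset `Z` of the flat `F`
(`#F = q + m`) the complementary basis meets `cl Z` exactly in `F ∖ Z` (`modelMatroid_flatPart_eq`), so `#(flatPart Z) = m`, and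
`recv(Z) = R̂(q, k, m)` (`modelMatroid_ruleQRecv_eq`). Hence (`modelRecvEq_flatPart`) every value `R̂(q, k, m)`, `m ≤ q`, is the
Rule Q receipt of a member at distance `q − m` from the top of an explicit finite matroid at the tight layer, and
* **`ruleQ_slice_iff_all`** — for `5 ≤ k ≤ 7`: «at the tight layer of EVERY finite matroid of the cell `(q+k, q)`, EVERY
  member `Z` with `q − #(flatPart Z) = u` receives at least `Φ(q+k, q)` under Rule Q's equal split, for EVERY `q ≥ u`»
  holds if and only if `u ∉ [2, k − 3]`;
* **`ruleQ_slice_iff_le_seven`** — the same for `2 ≤ k ≤ 7`: iff `k ≤ 4 ∨ u < 2 ∨ k − 2 ≤ u`;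
* **`ruleQUp_universal_iff`** — Rule Q's equal split pays every member of every cell of the family `k` (every `q ≥ 1`, every
  finite matroid at the tight layer) if and only if `k ≤ 4`;
* **`ruleQRecv_ge_phiK_of_top`** / **`exists_unpaid_slice_two`** — the two end slices `u ≤ 1` paid on every family `k ≥ 2`, the
  slice `u = 2` unpaid on the model of every family `k ≥ 5` (the `∀ k` ends of the map at the matroid level).
The negative half is witnessed on the model at the first `q` where the arithmetic fails; the positive half is
`ruleQRecv_ge_phiK_of_slice` / `ruleQUp_of_le_four`. Axioms: standard.
-/

namespace PercRepro

open Set Matroid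

variable {α : Type}

/-- **The flat part of a `q`-subset of the flat in the model**: for `Z ⊆ F ⊆ E` with `#Z = q < p`, the part of the complement
of `Z` inside `cl Z` is exactly `F ∖ Z` (inside `F` every further element is dependent on `Z`, outside `F` none is). -/
theorem modelMatroid_flatPart_eq {E F Z : Set α} (hE : E.Finite) (hF : F ⊆ E) (hZF : Z ⊆ F) {q p : ℕ} (hqp : q < p)
    (hZcard : Z.ncard = q) :
    flatPart (modelMatroid hE F q p) Z = F \ Z := by
  have hZE : Z ⊆ E := hZF.trans hF
  have hZfin : Z.Finite := hE.subset hZE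
  have hZind : (modelMatroid hE F q p).Indep Z := by
    rw [modelMatroid_indep_iff]
    refine ⟨hZE, ?_, ?_⟩
    · rw [Set.inter_eq_left.2 hZF, hZcard]
    · rw [hZcard]; exact hqp.le
  ext x
  simp only [flatPart, modelMatroid_E, Set.mem_inter_iff, Set.mem_sdiff]
  constructor
  · rintro ⟨⟨hxE, hxZ⟩, hxcl⟩
    refine ⟨?_, hxZ⟩
    rw [hZind.mem_closure_iff'] at hxcl
    by_contra hxF
    apply hxZ
    apply hxcl.2
    rw [modelMatroid_indep_iff]
    refine ⟨Set.insert_subset hxE hZE, ?_, ?_⟩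
    · have h : insert x Z ∩ F = Z := by
        ext y
        simp only [Set.mem_inter_iff, Set.mem_insert_iff]
        constructor
        · rintro ⟨hy | hy, hyF⟩
          · subst hy; exact absurd hyF hxF
          · exact hy
        · intro hy; exact ⟨Or.inr hy, hZF hy⟩
      rw [h, hZcard]
    · rw [Set.ncard_insert_of_notMem hxZ hZfin, hZcard]; exact hqp
  · rintro ⟨hxF, hxZ⟩
    refine ⟨⟨hF hxF, hxZ⟩, ?_⟩
    rw [hZind.mem_closure_iff']
    refine ⟨hF hxF, fun hind => ?_⟩
    exfalso
    rw [modelMatroid_indep_iff] at hind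
    obtain ⟨-, hind2, -⟩ := hind
    have h : insert x Z ∩ F = insert x Z := by
      rw [Set.inter_eq_left]; exact Set.insert_subset hxF hZF
    rw [h, Set.ncard_insert_of_notMem hxZ hZfin, hZcard] at hind2
    omega

/-- **The model identity with the flat part**: for `2 ≤ k`, `m ≤ q` an explicit finite matroid at the tight layer
`#E = (q+k) + q` with a member `Z` of the cell `(q+k, q)` whose flat part has `m` elements and whose Rule Q receipt is exactly
`R̂(q, k, m)` (the model `E = Iio (2q + k)`, `F = Iio (q + m)`, `Z = Iio q` on `ℕ`; every `q ≥ 0`). -/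
theorem modelRecvEq_flatPart (q k m : ℕ) (hk : 2 ≤ k) (hm : m ≤ q) :
    ∃ (α : Type) (M : Matroid α) (hf : M.Finite) (Z : Set α),
      M.E.ncard = (q + k) + q ∧ Z ∈ cellMembers M (q + k) q ∧ (flatPart M Z).ncard = m ∧
        @ruleQRecv α M hf (q + k) q Z = rhat q k m := by
  have hE : (Set.Iio (q + k + q) : Set ℕ).Finite := Set.finite_Iio _
  have hFE : Set.Iio (q + m) ⊆ Set.Iio (q + k + q) := Set.Iio_subset_Iio (by omega)
  have hZF : Set.Iio q ⊆ Set.Iio (q + m) := Set.Iio_subset_Iio (by omega)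
  have hEcard : (Set.Iio (q + k + q) : Set ℕ).ncard = (q + k) + q := ncard_Iio_nat _
  have hFcard : (Set.Iio (q + m) : Set ℕ).ncard = q + m := ncard_Iio_nat _
  have hZcard : (Set.Iio q : Set ℕ).ncard = q := ncard_Iio_nat _
  refine ⟨ℕ, modelMatroid hE (Set.Iio (q + m)) q (q + k), modelMatroid_finite hE _ _ _, Set.Iio q, ?_, ?_, ?_, ?_⟩
  · rw [modelMatroid_E, hEcard]
  · rw [modelMatroid_mem_cellMembers_iff hE hFE (by omega) hEcard]
    refine ⟨hZF.trans hFE, hZcard, ?_⟩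
    rw [Set.inter_eq_left.2 hZF, hZcard, hFcard]
    omega
  · rw [modelMatroid_flatPart_eq hE hFE hZF (by omega) hZcard, Set.ncard_sdiff hZF (Set.finite_Iio _), hFcard, hZcard]
    omega
  · rw [modelMatroid_ruleQRecv_eq hE hFE hk hEcard (by rw [hFcard]; omega) (by rw [hFcard]; omega) hZF hZcard, hFcard,
      Nat.add_sub_cancel_left]

/-- **THE SLICE MAP AT THE MATROID LEVEL, EXACT, `5 ≤ k ≤ 7`**: Rule Q's equal split pays every member `Z` at distance
`u = q − #(flatPart Z)` from the top, at the tight layer of every finite matroid of every cell `(q+k, q)` with `q ≥ u`,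
if and only if `u ∉ [2, k − 3]`. The negative half is the model matroid `T_{q+k}(U_{q, 2q−u} ⊕ free)` at a `q` where the
arithmetic fails (`rhat_slice_iff_all`). -/
theorem ruleQ_slice_iff_all (k u : ℕ) (hk5 : 5 ≤ k) (hk7 : k ≤ 7) :
    (∀ (β : Type) (M : Matroid β) (hf : M.Finite) (q : ℕ), u ≤ q → M.E.ncard = (q + k) + q →
        ∀ Z ∈ cellMembers M (q + k) q, (flatPart M Z).ncard = q - u →
          phiK (q + k) q ≤ @ruleQRecv β M hf (q + k) q Z)
      ↔ (u < 2 ∨ k - 2 ≤ u) := by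
  constructor
  · intro h
    by_contra hu
    have h' := (rhat_slice_iff_all k u hk5 hk7).not.2 hu
    push Not at h'
    obtain ⟨q, hq, hlt⟩ := h'
    obtain ⟨β, M, hf, Z, hE, hZ, hP, hrecv⟩ := modelRecvEq_flatPart q k (q - u) (by omega) (Nat.sub_le q u)
    have h1 := h β M hf q hq hE Z hZ hP
    rw [hrecv] at h1
    exact absurd h1 (not_le.mpr hlt)
  · intro hu β M hf q hq hE Z hZ hP
    exact @ruleQRecv_ge_phiK_of_slice β M hf q k u hk5 hk7 hu hq hE Z hZ hP

/-- **THE SLICE MAP AT THE MATROID LEVEL FOR EVERY FAMILY `2 ≤ k ≤ 7`**: the members at distance `u` from the top are paid by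
Rule Q's equal split at the tight layer of every finite matroid of every cell `(q+k, q)`, `q ≥ u`, if and only if
`k ≤ 4 ∨ u ≤ 1 ∨ u ≥ k − 2` — Rule Q's equal split is universal exactly on the families `k ≤ 4`, and on `k = 5, 6, 7` its deficit
is exactly the `k − 4` slices `2 ≤ q − #P ≤ k − 3`. -/
theorem ruleQ_slice_iff_le_seven (k u : ℕ) (hk2 : 2 ≤ k) (hk7 : k ≤ 7) :
    (∀ (β : Type) (M : Matroid β) (hf : M.Finite) (q : ℕ), u ≤ q → M.E.ncard = (q + k) + q →
        ∀ Z ∈ cellMembers M (q + k) q, (flatPart M Z).ncard = q - u →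
          phiK (q + k) q ≤ @ruleQRecv β M hf (q + k) q Z)
      ↔ (k ≤ 4 ∨ u < 2 ∨ k - 2 ≤ u) := by
  rcases Nat.lt_or_ge k 5 with hlt | hge
  · refine ⟨fun _ => Or.inl (by omega), fun _ β M hf q hq hE Z hZ hP => ?_⟩
    have h1 := rhat_slice_of_le_four k u hk2 (by omega) q hq
    have h2 := @rhat_le_ruleQRecv β M hf q k hE Z hZ
    rw [hP] at h2
    exact h1.trans h2
  · rw [ruleQ_slice_iff_all k u hge hk7]
    omega

/-- **Rule Q's equal split is a universal mechanism of the UP form on the cell family `k` if and only if `k ≤ 4`**: for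
`k ≤ 4` every member of every cell `(q+k, q)` at the tight layer of every finite matroid is paid (p4's `ruleQUp_of_le_four`),
for `k ≥ 5` the model matroid at `q = 4^{k+3} + 2` has an unpaid member (`not_ruleQUp_of_five_le`). -/
theorem ruleQUp_universal_iff (k : ℕ) (hk : 2 ≤ k) :
    (∀ (β : Type) (M : Matroid β) (hf : M.Finite) (q : ℕ), 1 ≤ q → M.E.ncard = (q + k) + q →
        @RuleQUp β M hf (q + k) q)
      ↔ k ≤ 4 := by
  constructor
  · intro h
    by_contra hk5
    push Not at hk5
    obtain ⟨β, M, hf, hE, hnot⟩ := not_ruleQUp_of_five_le k hk5 (4 ^ (k + 3) + 2) le_rfl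
    exact hnot (h β M hf _ (Nat.one_le_iff_ne_zero.mpr (by positivity)) hE)
  · intro hk4 β M hf q hq hE
    exact @ruleQUp_of_le_four β M hf q k hq hk hk4 hE

/-- **The two end slices at the matroid level, every family `k ≥ 2`**: a member whose complementary basis meets `cl Z` in at
least `q − 1` elements is paid on every cell `(q+k, q)` of every finite matroid at the tight layer (`rhatCell_self` /
`rhatCell_pred` through `rhat_le_ruleQRecv`). -/
theorem ruleQRecv_ge_phiK_of_top {β : Type} (M : Matroid β) [M.Finite] {q k : ℕ} (hk : 2 ≤ k)
    (hE : M.E.ncard = (q + k) + q) {Z : Set β} (hZ : Z ∈ cellMembers M (q + k) q)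
    (hP : q ≤ (flatPart M Z).ncard + 1) :
    phiK (q + k) q ≤ ruleQRecv M (q + k) q Z := by
  have hm := ncard_flatPart_le M hE hZ
  refine le_trans ?_ (rhat_le_ruleQRecv M hE hZ)
  rcases Nat.lt_or_ge (flatPart M Z).ncard q with hlt | hge
  · have h : (flatPart M Z).ncard = q - 1 := by omega
    rw [h]; exact rhatCell_pred q k (by omega) hk
  · have h : (flatPart M Z).ncard = q := le_antisymm hm hge
    rw [h]; exact rhatCell_self q k hk

/-- **The slice `u = 2` at the matroid level, every family `k ≥ 5`**: for `q ≥ 4^{k+3} + 2` the model matroid has a member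
with `#(flatPart Z) = q − 2` that Rule Q's equal split does not pay (`rhat_lt_phiK_of_five_le`). -/
theorem exists_unpaid_slice_two (k : ℕ) (hk : 5 ≤ k) (q : ℕ) (hq : 4 ^ (k + 3) + 2 ≤ q) :
    ∃ (β : Type) (M : Matroid β) (hf : M.Finite) (Z : Set β), M.E.ncard = (q + k) + q ∧ Z ∈ cellMembers M (q + k) q ∧
      (flatPart M Z).ncard = q - 2 ∧ @ruleQRecv β M hf (q + k) q Z < phiK (q + k) q := by
  have h2 : 2 ≤ q := le_trans (Nat.le_add_left 2 _) hq
  obtain ⟨m, rfl⟩ : ∃ m, q = m + 2 := ⟨q - 2, by omega⟩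
  obtain ⟨β, M, hf, Z, hE, hZ, hP, hrecv⟩ := modelRecvEq_flatPart (m + 2) k m (by omega) (Nat.le_add_right m 2)
  refine ⟨β, M, hf, Z, hE, hZ, by rw [hP]; omega, ?_⟩
  rw [hrecv]
  exact rhat_lt_phiK_of_five_le k hk m (Nat.le_of_add_le_add_right hq)

end PercRepro
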